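import Summits.Ventures.YMGap.Thresholds.PressureDerivative
import HarnessLib

/-!
# The free energy density of `SU(N)` lattice Yang–Mills is `C²` on the strong-coupling window — every `N ≥ 2` at
# 't Hooft `b/N < 9/308` (`d = 4`) and every dimension `d ≥ 2` at `(d-1) b/N < 1/12` (row type C-PRESS, part 3)

Cell `pub-ymgap`, seat ds-1 (gen 9). HONEST FRAMING: strong-coupling LATTICE statements for `SU(N)` Wilson lattice gauge
theory on `ℤ^d`, HYPOTHESIS-FREE (the one-link input is the Bakry–Émery modulus `oneLinkKRModulus_SU`, a tree theorem);
`C¹`/`C²` regularity of the infinite-volume free energy density `f(b) = freeEnergyDensity d ρ_N b` in the tree coupling `b`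
— NOT analyticity; the windows are where the one-sided vertex-star Dobrushin bound closes (`d = 4`: Lemma-G bookkeeping,
`b < N·9/308`; every `d`: resolvent bookkeeping, `b < N/(12(d-1))`), not transitions; nothing about the continuum or Clay.
Kernel theorems only, 0 compute.

Mechanism = part 1 (`hasDerivWithinAt_freeEnergyDensity`: energy-subgradient chords of `FibreToTorus.energy_pressure_chord`
squeezed by continuity of the energy density; translation invariance of the unique state) fed with g8's every-`N` /
every-`d` C-LIP-STAR and C-DIFF (`continuousOn_integral_SU/_dim`, `hasDerivAt_plaquette_SU_thooft/_dim_thooft`,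
`continuousOn_responseSum_SU/_dim`) and uniqueness (`hasUniqueGibbsMeasure_of_modulus/_dim`).

* `hasDerivWithinAt_freeEnergyDensity_SU_of_modulus` — socket: any one-link KR modulus closing the `d = 4` star door up to `b₁`;
* ★ `hasDerivWithinAt/hasDerivAt_freeEnergyDensity_SU_thooft`, `deriv_freeEnergyDensity_eq_SU_thooft` — every `N ≥ 2`, `d = 4`:
  `f'(b) = -Σ_{i<j} (N - ⟨Re tr U_{p_ij}⟩_{μ_b})` at every `b ∈ [0, N·9/308]` (one-sided at the ends), for every DLR state;
* ★★ `hasDerivAt_deriv_freeEnergyDensity_SU_thooft`, `contDiffOn_two_freeEnergyDensity_SU_thooft` —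
  `f''(b) = Σ_{i<j} N² Σ_q Cov_{μ_b}(W_{p_ij}, W_q)` (`W = (1/N) Re tr`) and `f ∈ C²` on `(0, N·9/308)`;
* ★ / ★★ the same in every dimension `d ≥ 2` on `[0, N/(12(d-1))]`: `hasDerivWithinAt/hasDerivAt_freeEnergyDensity_dim_thooft`,
  `deriv_freeEnergyDensity_eq_dim_thooft`, `hasDerivAt_deriv_freeEnergyDensity_dim_thooft`,
  `contDiffOn_two_freeEnergyDensity_dim_thooft`; `dim_four_window_lt_star_window` records that in `d = 4` the dedicated row
  is wider (`N/36 < N·9/308`).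
-/

noncomputable section

open MeasureTheory ProbabilityTheory Set Filter Topology
open scoped NNReal
open Literature.MathematicalPhysics.QuantumLattice (LGConfig ZdEdge ZdPlaquette fundamentalRep ymGibbsMeasures
  ymSpecification plaquetteObs plaquetteEdges freeEnergyDensity IsZdTranslationInvariant
  infiniteVolumeLimitPoints_nonempty_holds mem_ymGibbsMeasuresTI_of_mem_infiniteVolumeLimitPoints
  continuous_fundamentalRep)
open Literature.MathematicalPhysics.QuantumFieldTheory hiding ZdEdge
open Summit.QuantumFields.YangMills.Theorems.FibreToTorus (energy_pressure_chord)

namespace Summit.Ventures.YMGap.PressureRegularity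

open Summit.Ventures.YMGap.CouplingResponse (continuousOn_integral_SU continuousOn_responseSum_SU
  hasUniqueGibbsMeasure_of_modulus hasDerivAt_plaquette_SU_thooft contDiffOn_one_of_hasDerivAt
  continuousOn_integral_dim continuousOn_responseSum_dim hasDerivAt_plaquette_dim_thooft bakryEmery_door_dim
  plaquetteObs_fundamentalRep_eq_mul_zdPlaquetteObs)
open Literature.MathematicalPhysics.QuantumFieldTheory.Balaban1983to89.StrongCouplingDobrushinWindow (OneLinkKRModulus)
open Literature.MathematicalPhysics.QuantumFieldTheory.Balaban1983to89.StrongCouplingKernelWindow (oneLinkKRModulus_SU)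
open Summit.Ventures.YMGap.StarResolventDim (doorPoly)

variable {d N : ℕ}

/-- Local shorthand: the planes `{(i, j) : i < j}`. -/
local notation3 (prettyPrint := false) "𝔓" d => {q : Fin d × Fin d // q.1 < q.2}

/-- `SU(N)` is second countable (closed subgroup of `N × N` complex matrices). [folklore] -/
private theorem secondCountable_suN : SecondCountableTopology (Matrix.specialUnitaryGroup (Fin N) ℂ) :=
  haveI : SecondCountableTopology (Matrix (Fin N) (Fin N) ℂ) :=
    inferInstanceAs (SecondCountableTopology (Fin N → Fin N → ℂ))
  Topology.IsEmbedding.subtypeVal.secondCountableTopology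

/-- `Re tr U_p = N · W_p` under the integral. [folklore] -/
theorem integral_plaquetteObs_eq_mul (p : ZdPlaquette d) (μ : Measure (LGConfig d (Matrix.specialUnitaryGroup (Fin N) ℂ))) :
    ∫ U, plaquetteObs (fundamentalRep (Fin N)) p.1 p.2.1.1 p.2.1.2 U ∂μ =
      (N : ℝ) * ∫ U, zdPlaquetteObs (fundamentalRep (Fin N)) p.1 p.2.1.1 p.2.1.2 U ∂μ := by
  rw [← integral_const_mul]
  exact integral_congr_ae (ae_of_all _ fun U => plaquetteObs_fundamentalRep_eq_mul_zdPlaquetteObs _ _ _ U)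

/-! ## `SU(N)`, `d = 4`, window fed by any one-link KR modulus -/

section SUN

/-- **Every `SU(N)`, `N ≥ 2`, `d = 4`: ONE DLR state on the closed 't Hooft window `[0, N·9/308]`**, hypothesis-free
(Bakry–Émery modulus; `CouplingResponse.hasUniqueGibbsMeasure_of_modulus`). -/
theorem subsingleton_ymGibbsMeasures_SU_thooft (hN : 2 ≤ N) {b : ℝ} (hb : b ∈ Icc (0 : ℝ) ((N : ℝ) * (9 / 308))) :
    (ymGibbsMeasures (d := 4) (fundamentalRep (Fin N)) b).Subsingleton := by
  have hN0 : (0 : ℝ) < N := by exact_mod_cast (show 0 < N by omega)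
  set b₁ : ℝ := (N : ℝ) * (9 / 308) with hb₁
  have hb₁N : b₁ / N = 9 / 308 := by rw [hb₁]; field_simp
  have hb₁0 : 0 ≤ b₁ := by positivity
  obtain ⟨h1, hK0, h4⟩ := StarSUN.bakryEmery_coef_le (by omega) hb₁0 hb₁N.le
  have hab : |b₁| / N = b₁ / N := by rw [abs_of_nonneg hb₁0]
  rw [hab] at h1 hK0 h4
  exact (hasUniqueGibbsMeasure_of_modulus (by omega) hK0 (oneLinkKRModulus_SU hN h1) le_rfl h4 hb.1 hb.2).1

/-- **Every `SU(N)`, `N ≥ 2`, every `d ≥ 2`: ONE DLR state on the closed window `[0, N/(12(d-1))]`**, hypothesis-free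
(`CouplingResponse.hasUniqueGibbsMeasure_of_modulus_dim`). -/
theorem subsingleton_ymGibbsMeasures_dim_thooft (hd : 2 ≤ d) (hN : 2 ≤ N) {b : ℝ}
    (hb : b ∈ Icc (0 : ℝ) ((N : ℝ) / (12 * ((d : ℝ) - 1)))) :
    (ymGibbsMeasures (d := d) (fundamentalRep (Fin N)) b).Subsingleton := by
  obtain ⟨h1, hK0, hdoor⟩ := bakryEmery_door_dim (N := N) hd (by omega)
  exact (CouplingResponse.hasUniqueGibbsMeasure_of_modulus_dim hd (by omega) hK0 (oneLinkKRModulus_SU hN h1) le_rfl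
    hdoor hb.1 hb.2).1

/-- **`SU(N)`, `d = 4`, socket form**: for any one-link KR modulus closing the vertex-star door up to `b₁`
(`b₁/N · 6 ≤ R`, `4 K b₁/N ≤ 9/25`), along any DLR selection on `[0, b₁]` the free energy density has derivative
`-Σ_{i<j} (N - ⟨Re tr U_{p_ij}⟩_{μ b})` within `[0, b₁]` at every `b ∈ [0, b₁]`. -/
theorem hasDerivWithinAt_freeEnergyDensity_SU_of_modulus (hN : 1 ≤ N) {R K b₁ : ℝ} (hK0 : 0 ≤ K)
    (hmod : OneLinkKRModulus N R K) (hR : b₁ / N * 6 ≤ R) (h925 : 4 * (K * (b₁ / N)) ≤ 9 / 25)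
    {μ : ℝ → Measure (LGConfig 4 (Matrix.specialUnitaryGroup (Fin N) ℂ))}
    (hμ : ∀ b ∈ Icc (0 : ℝ) b₁, μ b ∈ ymGibbsMeasures (d := 4) (fundamentalRep (Fin N)) b)
    {b : ℝ} (hb : b ∈ Icc (0 : ℝ) b₁) :
    HasDerivWithinAt (freeEnergyDensity 4 (fundamentalRep (Fin N)))
      (-∑ q : 𝔓 4, ((N : ℝ) - ∫ U, plaquetteObs (fundamentalRep (Fin N)) 0 q.1.1 q.1.2 U ∂(μ b))) (Icc (0 : ℝ) b₁) b := by
  haveI := secondCountable_suN (N := N)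
  refine hasDerivWithinAt_freeEnergyDensity (d := 4) (fundamentalRep (Fin N)) (continuous_fundamentalRep _) hμ
    (fun t ht => isZdTranslationInvariant_of_subsingleton _ (continuous_fundamentalRep _)
      (hasUniqueGibbsMeasure_of_modulus hN hK0 hmod hR h925 ht.1 ht.2).1 (hμ t ht)) hb fun q => ?_
  have hc := continuousOn_integral_SU hN hK0 hmod hR h925 hμ
    (isLipschitzCylinder_zdPlaquetteObs (N := N) (0 : Literature.Probability.LatticeModels.Site 4) q.2)
    (x₀ := 0) (D := 1) (fun e he => by simpa using norm_fst_sub_le_of_mem_plaquetteEdges he)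
  refine (((continuousOn_const (c := (N : ℝ))).mul hc).congr fun t _ => ?_) b hb
  exact integral_plaquetteObs_eq_mul ((0 : Literature.Probability.LatticeModels.Site 4), q) (μ t)

/-- ★ **Every `SU(N)`, `N ≥ 2`, `d = 4`, HYPOTHESIS-FREE (Bakry–Émery modulus): the free energy density is differentiable
at every tree coupling `b ∈ [0, N·9/308]` ('t Hooft `b/N ≤ 9/308`), one-sided at the endpoints**, with derivative minus
the energy density of the unique DLR state, along any DLR selection. -/
theorem hasDerivWithinAt_freeEnergyDensity_SU_thooft (hN : 2 ≤ N)
    {μ : ℝ → Measure (LGConfig 4 (Matrix.specialUnitaryGroup (Fin N) ℂ))}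
    (hμ : ∀ b ∈ Icc (0 : ℝ) ((N : ℝ) * (9 / 308)), μ b ∈ ymGibbsMeasures (d := 4) (fundamentalRep (Fin N)) b)
    {b : ℝ} (hb : b ∈ Icc (0 : ℝ) ((N : ℝ) * (9 / 308))) :
    HasDerivWithinAt (freeEnergyDensity 4 (fundamentalRep (Fin N)))
      (-∑ q : 𝔓 4, ((N : ℝ) - ∫ U, plaquetteObs (fundamentalRep (Fin N)) 0 q.1.1 q.1.2 U ∂(μ b)))
      (Icc (0 : ℝ) ((N : ℝ) * (9 / 308))) b := by
  have hN0 : (0 : ℝ) < N := by exact_mod_cast (show 0 < N by omega)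
  set b₁ : ℝ := (N : ℝ) * (9 / 308) with hb₁
  have hb₁N : b₁ / N = 9 / 308 := by rw [hb₁]; field_simp
  have hb₁0 : 0 ≤ b₁ := by positivity
  obtain ⟨h1, hK0, h4⟩ := StarSUN.bakryEmery_coef_le (by omega) hb₁0 hb₁N.le
  have hab : |b₁| / N = b₁ / N := by rw [abs_of_nonneg hb₁0]
  rw [hab] at h1 hK0 h4
  exact hasDerivWithinAt_freeEnergyDensity_SU_of_modulus (by omega) hK0 (oneLinkKRModulus_SU hN h1) le_rfl h4 hμ hb

/-- ★ **Every `SU(N)`, `N ≥ 2`, `d = 4`: `HasDerivAt f (-e(μ_b)) b` at every `0 < b < N·9/308`**, hypothesis-free. -/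
theorem hasDerivAt_freeEnergyDensity_SU_thooft (hN : 2 ≤ N)
    {μ : ℝ → Measure (LGConfig 4 (Matrix.specialUnitaryGroup (Fin N) ℂ))}
    (hμ : ∀ b ∈ Icc (0 : ℝ) ((N : ℝ) * (9 / 308)), μ b ∈ ymGibbsMeasures (d := 4) (fundamentalRep (Fin N)) b)
    {b : ℝ} (hb : b ∈ Ioo (0 : ℝ) ((N : ℝ) * (9 / 308))) :
    HasDerivAt (freeEnergyDensity 4 (fundamentalRep (Fin N)))
      (-∑ q : 𝔓 4, ((N : ℝ) - ∫ U, plaquetteObs (fundamentalRep (Fin N)) 0 q.1.1 q.1.2 U ∂(μ b))) b :=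
  (hasDerivWithinAt_freeEnergyDensity_SU_thooft hN hμ (Ioo_subset_Icc_self hb)).hasDerivAt (Icc_mem_nhds hb.1 hb.2)

/-- **The thermodynamic identity for every `SU(N)`**: `f'(b) = -Σ_{i<j} (N - ⟨Re tr U_{p_ij}⟩_ν)` for every DLR state
`ν ∈ 𝒢(b)`, `0 < b < N·9/308`. -/
theorem deriv_freeEnergyDensity_eq_SU_thooft (hN : 2 ≤ N) {b : ℝ} (hb : b ∈ Ioo (0 : ℝ) ((N : ℝ) * (9 / 308)))
    {ν : Measure (LGConfig 4 (Matrix.specialUnitaryGroup (Fin N) ℂ))}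
    (hν : ν ∈ ymGibbsMeasures (d := 4) (fundamentalRep (Fin N)) b) :
    deriv (freeEnergyDensity 4 (fundamentalRep (Fin N))) b =
      -∑ q : 𝔓 4, ((N : ℝ) - ∫ U, plaquetteObs (fundamentalRep (Fin N)) 0 q.1.1 q.1.2 U ∂ν) := by
  classical
  obtain ⟨μ, hμ⟩ := CouplingResponse.exists_dlrSelection_SU (N := N)
  have hsel : ∀ t ∈ Icc (0 : ℝ) ((N : ℝ) * (9 / 308)),
      (fun t => if t = b then ν else μ t) t ∈ ymGibbsMeasures (d := 4) (fundamentalRep (Fin N)) t := by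
    intro t _
    by_cases ht : t = b
    · simp only [ht, if_true]; exact hν
    · simp only [ht, if_false]; exact hμ t
  simpa using (hasDerivAt_freeEnergyDensity_SU_thooft hN hsel hb).deriv

/-- ★★ **Every `SU(N)`, `N ≥ 2`, `d = 4`: the free energy density is TWICE differentiable at every `0 < b < N·9/308`**,
`(f')'(b) = Σ_{i<j} N² Σ_q Cov_{μ b}(W_{p_ij}, W_q)` (`W = (1/N) Re tr`, the plaquette susceptibility), hypothesis-free. -/
theorem hasDerivAt_deriv_freeEnergyDensity_SU_thooft (hN : 2 ≤ N)
    {μ : ℝ → Measure (LGConfig 4 (Matrix.specialUnitaryGroup (Fin N) ℂ))}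
    (hμ : ∀ b ∈ Icc (0 : ℝ) ((N : ℝ) * (9 / 308)), μ b ∈ ymGibbsMeasures (d := 4) (fundamentalRep (Fin N)) b)
    {b : ℝ} (hb : b ∈ Ioo (0 : ℝ) ((N : ℝ) * (9 / 308))) :
    HasDerivAt (deriv (freeEnergyDensity 4 (fundamentalRep (Fin N))))
      (∑ q : 𝔓 4, (N : ℝ) ^ 2 * ∑' r : ZdPlaquette 4, cov[zdPlaquetteObs (fundamentalRep (Fin N)) 0 q.1.1 q.1.2,
        zdPlaquetteObs (fundamentalRep (Fin N)) r.1 r.2.1.1 r.2.1.2; μ b]) b := by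
  have hplane : ∀ q : 𝔓 4, HasDerivAt
      (fun t => (N : ℝ) - ∫ U, plaquetteObs (fundamentalRep (Fin N)) 0 q.1.1 q.1.2 U ∂(μ t))
      (0 - (N : ℝ) * ((N : ℝ) * ∑' r : ZdPlaquette 4, cov[zdPlaquetteObs (fundamentalRep (Fin N)) 0 q.1.1 q.1.2,
        zdPlaquetteObs (fundamentalRep (Fin N)) r.1 r.2.1.1 r.2.1.2; μ b])) b := fun q => by
    refine (hasDerivAt_const b (N : ℝ)).sub ?_
    have h := (hasDerivAt_plaquette_SU_thooft hN hμ ((0 : Literature.Probability.LatticeModels.Site 4), q) hb).const_mul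
      (N : ℝ)
    refine h.congr_of_eventuallyEq (Filter.Eventually.of_forall fun t => ?_)
    exact integral_plaquetteObs_eq_mul ((0 : Literature.Probability.LatticeModels.Site 4), q) (μ t)
  have hsum := (HasDerivAt.fun_sum (u := (Finset.univ : Finset (𝔓 4))) fun q _ => hplane q).fun_neg
  have he : HasDerivAt (fun t => -∑ q : 𝔓 4, ((N : ℝ) - ∫ U, plaquetteObs (fundamentalRep (Fin N)) 0 q.1.1 q.1.2 U ∂(μ t)))
      (∑ q : 𝔓 4, (N : ℝ) ^ 2 * ∑' r : ZdPlaquette 4, cov[zdPlaquetteObs (fundamentalRep (Fin N)) 0 q.1.1 q.1.2,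
        zdPlaquetteObs (fundamentalRep (Fin N)) r.1 r.2.1.1 r.2.1.2; μ b]) b := by
    refine hsum.congr_deriv ?_
    rw [← Finset.sum_neg_distrib]
    exact Finset.sum_congr rfl fun q _ => by ring
  refine he.congr_of_eventuallyEq ?_
  filter_upwards [Ioo_mem_nhds hb.1 hb.2] with t ht
  exact (hasDerivAt_freeEnergyDensity_SU_thooft hN hμ ht).deriv

/-- ★ / ★★ **Selection-free forms, every `SU(N)`, `d = 4`**: for EVERY DLR state `ν ∈ 𝒢(b)`, `0 < b < N·9/308`,
`HasDerivAt f (-Σ_{i<j} (N - ⟨Re tr U_{p_ij}⟩_ν)) b` and `HasDerivAt f' (Σ_{i<j} N² Σ_q Cov_ν(W_{p_ij}, W_q)) b`. -/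
theorem hasDerivAt_freeEnergyDensity_SU_thooft_of_mem (hN : 2 ≤ N) {b : ℝ} (hb : b ∈ Ioo (0 : ℝ) ((N : ℝ) * (9 / 308)))
    {ν : Measure (LGConfig 4 (Matrix.specialUnitaryGroup (Fin N) ℂ))}
    (hν : ν ∈ ymGibbsMeasures (d := 4) (fundamentalRep (Fin N)) b) :
    HasDerivAt (freeEnergyDensity 4 (fundamentalRep (Fin N)))
        (-∑ q : 𝔓 4, ((N : ℝ) - ∫ U, plaquetteObs (fundamentalRep (Fin N)) 0 q.1.1 q.1.2 U ∂ν)) b ∧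
      HasDerivAt (deriv (freeEnergyDensity 4 (fundamentalRep (Fin N))))
        (∑ q : 𝔓 4, (N : ℝ) ^ 2 * ∑' r : ZdPlaquette 4, cov[zdPlaquetteObs (fundamentalRep (Fin N)) 0 q.1.1 q.1.2,
          zdPlaquetteObs (fundamentalRep (Fin N)) r.1 r.2.1.1 r.2.1.2; ν]) b := by
  classical
  obtain ⟨μ, hμ⟩ := CouplingResponse.exists_dlrSelection_SU (N := N)
  have hsel : ∀ t ∈ Icc (0 : ℝ) ((N : ℝ) * (9 / 308)),
      (fun t => if t = b then ν else μ t) t ∈ ymGibbsMeasures (d := 4) (fundamentalRep (Fin N)) t := by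
    intro t _
    by_cases ht : t = b
    · simp only [ht, if_true]; exact hν
    · simp only [ht, if_false]; exact hμ t
  constructor
  · simpa using hasDerivAt_freeEnergyDensity_SU_thooft hN hsel hb
  · simpa using hasDerivAt_deriv_freeEnergyDensity_SU_thooft hN hsel hb

/-- ★★ **Every `SU(N)`, `N ≥ 2`, `d = 4`: `f ∈ C²` on the open window `(0, N·9/308)`**, hypothesis-free. -/
theorem contDiffOn_two_freeEnergyDensity_SU_thooft (hN : 2 ≤ N) :
    ContDiffOn ℝ 2 (freeEnergyDensity 4 (fundamentalRep (Fin N))) (Ioo (0 : ℝ) ((N : ℝ) * (9 / 308))) := by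
  obtain ⟨μ, hμ⟩ := CouplingResponse.exists_dlrSelection_SU (N := N)
  have hsel : ∀ t ∈ Icc (0 : ℝ) ((N : ℝ) * (9 / 308)), μ t ∈ ymGibbsMeasures (d := 4) (fundamentalRep (Fin N)) t :=
    fun t _ => hμ t
  have hN0 : (0 : ℝ) < N := by exact_mod_cast (show 0 < N by omega)
  set b₁ : ℝ := (N : ℝ) * (9 / 308) with hb₁
  have hb₁N : b₁ / N = 9 / 308 := by rw [hb₁]; field_simp
  have hb₁0 : 0 ≤ b₁ := by positivity
  obtain ⟨h1, hK0, h4⟩ := StarSUN.bakryEmery_coef_le (by omega) hb₁0 hb₁N.le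
  have hab : |b₁| / N = b₁ / N := by rw [abs_of_nonneg hb₁0]
  rw [hab] at h1 hK0 h4
  have hmod := oneLinkKRModulus_SU hN h1
  rw [show (2 : WithTop ℕ∞) = 1 + 1 from rfl, contDiffOn_succ_iff_deriv_of_isOpen isOpen_Ioo]
  refine ⟨fun t ht => (hasDerivAt_freeEnergyDensity_SU_thooft hN hsel ht).differentiableAt.differentiableWithinAt,
    fun h => absurd h (by simp), ?_⟩
  refine contDiffOn_one_of_hasDerivAt (fun t ht => hasDerivAt_deriv_freeEnergyDensity_SU_thooft hN hsel ht) ?_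
  refine continuousOn_finsetSum _ fun q _ => continuousOn_const.mul ?_
  exact continuousOn_responseSum_SU (by omega) hK0 hmod le_rfl h4 hsel
    (isLipschitzCylinder_zdPlaquetteObs (N := N) (0 : Literature.Probability.LatticeModels.Site 4) q.2)
    (x₀ := 0) (D := 1) (fun e he => by simpa using norm_fst_sub_le_of_mem_plaquetteEdges he)

end SUN

/-! ## Every `SU(N)`, every dimension `d ≥ 2`, 't Hooft window `(d-1) b/N < 1/12` -/

section Dim

/-- ★ **Every `SU(N)`, `N ≥ 2`, EVERY `d ≥ 2`, HYPOTHESIS-FREE: the free energy density of `SU(N)` lattice Yang–Mills on `ℤ^d`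
is differentiable at every tree coupling `b ∈ [0, N/(12(d-1))]`, one-sided at the endpoints**, derivative minus the energy
density `Σ_{i<j} (N - ⟨Re tr U_{p_ij}⟩_{μ b})` of the unique DLR state, along any DLR selection. -/
theorem hasDerivWithinAt_freeEnergyDensity_dim_thooft (hd : 2 ≤ d) (hN : 2 ≤ N)
    {μ : ℝ → Measure (LGConfig d (Matrix.specialUnitaryGroup (Fin N) ℂ))}
    (hμ : ∀ b ∈ Icc (0 : ℝ) ((N : ℝ) / (12 * ((d : ℝ) - 1))), μ b ∈ ymGibbsMeasures (d := d) (fundamentalRep (Fin N)) b)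
    {b : ℝ} (hb : b ∈ Icc (0 : ℝ) ((N : ℝ) / (12 * ((d : ℝ) - 1)))) :
    HasDerivWithinAt (freeEnergyDensity d (fundamentalRep (Fin N)))
      (-∑ q : 𝔓 d, ((N : ℝ) - ∫ U, plaquetteObs (fundamentalRep (Fin N)) 0 q.1.1 q.1.2 U ∂(μ b)))
      (Icc (0 : ℝ) ((N : ℝ) / (12 * ((d : ℝ) - 1)))) b := by
  haveI := secondCountable_suN (N := N)
  obtain ⟨h1, hK0, hdoor⟩ := bakryEmery_door_dim (N := N) hd (by omega)
  have hmod := oneLinkKRModulus_SU hN h1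
  refine hasDerivWithinAt_freeEnergyDensity (d := d) (fundamentalRep (Fin N)) (continuous_fundamentalRep _) hμ
    (fun t ht => isZdTranslationInvariant_of_subsingleton _ (continuous_fundamentalRep _)
      (CouplingResponse.hasUniqueGibbsMeasure_of_modulus_dim hd (by omega) hK0 hmod le_rfl hdoor ht.1 ht.2).1
      (hμ t ht)) hb fun q => ?_
  have hc := continuousOn_integral_dim hd (by omega) hK0 hmod le_rfl hdoor hμ
    (isLipschitzCylinder_zdPlaquetteObs (N := N) (0 : Literature.Probability.LatticeModels.Site d) q.2)
    (x₀ := 0) (D := 1) (fun e he => by simpa using norm_fst_sub_le_of_mem_plaquetteEdges he)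
  refine (((continuousOn_const (c := (N : ℝ))).mul hc).congr fun t _ => ?_) b hb
  exact integral_plaquetteObs_eq_mul ((0 : Literature.Probability.LatticeModels.Site d), q) (μ t)

/-- ★ **Every `SU(N)`, every `d ≥ 2`: `HasDerivAt f (-e(μ_b)) b` at every `0 < b < N/(12(d-1))`**, hypothesis-free. -/
theorem hasDerivAt_freeEnergyDensity_dim_thooft (hd : 2 ≤ d) (hN : 2 ≤ N)
    {μ : ℝ → Measure (LGConfig d (Matrix.specialUnitaryGroup (Fin N) ℂ))}
    (hμ : ∀ b ∈ Icc (0 : ℝ) ((N : ℝ) / (12 * ((d : ℝ) - 1))), μ b ∈ ymGibbsMeasures (d := d) (fundamentalRep (Fin N)) b)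
    {b : ℝ} (hb : b ∈ Ioo (0 : ℝ) ((N : ℝ) / (12 * ((d : ℝ) - 1)))) :
    HasDerivAt (freeEnergyDensity d (fundamentalRep (Fin N)))
      (-∑ q : 𝔓 d, ((N : ℝ) - ∫ U, plaquetteObs (fundamentalRep (Fin N)) 0 q.1.1 q.1.2 U ∂(μ b))) b :=
  (hasDerivWithinAt_freeEnergyDensity_dim_thooft hd hN hμ (Ioo_subset_Icc_self hb)).hasDerivAt
    (Icc_mem_nhds hb.1 hb.2)

/-- **The thermodynamic identity, every `SU(N)`, every `d ≥ 2`**: `f'(b) = -Σ_{i<j} (N - ⟨Re tr U_{p_ij}⟩_ν)` for every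
DLR state `ν ∈ 𝒢(b)`, `0 < b < N/(12(d-1))`. -/
theorem deriv_freeEnergyDensity_eq_dim_thooft (hd : 2 ≤ d) (hN : 2 ≤ N) {b : ℝ}
    (hb : b ∈ Ioo (0 : ℝ) ((N : ℝ) / (12 * ((d : ℝ) - 1))))
    {ν : Measure (LGConfig d (Matrix.specialUnitaryGroup (Fin N) ℂ))}
    (hν : ν ∈ ymGibbsMeasures (d := d) (fundamentalRep (Fin N)) b) :
    deriv (freeEnergyDensity d (fundamentalRep (Fin N))) b =
      -∑ q : 𝔓 d, ((N : ℝ) - ∫ U, plaquetteObs (fundamentalRep (Fin N)) 0 q.1.1 q.1.2 U ∂ν) := by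
  classical
  obtain ⟨μ, hμ⟩ := CouplingResponse.exists_dlrSelection_dim (d := d) (N := N)
  have hsel : ∀ t ∈ Icc (0 : ℝ) ((N : ℝ) / (12 * ((d : ℝ) - 1))),
      (fun t => if t = b then ν else μ t) t ∈ ymGibbsMeasures (d := d) (fundamentalRep (Fin N)) t := by
    intro t _
    by_cases ht : t = b
    · simp only [ht, if_true]; exact hν
    · simp only [ht, if_false]; exact hμ t
  simpa using (hasDerivAt_freeEnergyDensity_dim_thooft hd hN hsel hb).deriv

/-- ★★ **Every `SU(N)`, every `d ≥ 2`: the free energy density is TWICE differentiable at every `0 < b < N/(12(d-1))`**,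
`(f')'(b) = Σ_{i<j} N² Σ_q Cov_{μ b}(W_{p_ij}, W_q)`, hypothesis-free. -/
theorem hasDerivAt_deriv_freeEnergyDensity_dim_thooft (hd : 2 ≤ d) (hN : 2 ≤ N)
    {μ : ℝ → Measure (LGConfig d (Matrix.specialUnitaryGroup (Fin N) ℂ))}
    (hμ : ∀ b ∈ Icc (0 : ℝ) ((N : ℝ) / (12 * ((d : ℝ) - 1))), μ b ∈ ymGibbsMeasures (d := d) (fundamentalRep (Fin N)) b)
    {b : ℝ} (hb : b ∈ Ioo (0 : ℝ) ((N : ℝ) / (12 * ((d : ℝ) - 1)))) :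
    HasDerivAt (deriv (freeEnergyDensity d (fundamentalRep (Fin N))))
      (∑ q : 𝔓 d, (N : ℝ) ^ 2 * ∑' r : ZdPlaquette d, cov[zdPlaquetteObs (fundamentalRep (Fin N)) 0 q.1.1 q.1.2,
        zdPlaquetteObs (fundamentalRep (Fin N)) r.1 r.2.1.1 r.2.1.2; μ b]) b := by
  have hplane : ∀ q : 𝔓 d, HasDerivAt
      (fun t => (N : ℝ) - ∫ U, plaquetteObs (fundamentalRep (Fin N)) 0 q.1.1 q.1.2 U ∂(μ t))
      (0 - (N : ℝ) * ((N : ℝ) * ∑' r : ZdPlaquette d, cov[zdPlaquetteObs (fundamentalRep (Fin N)) 0 q.1.1 q.1.2,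
        zdPlaquetteObs (fundamentalRep (Fin N)) r.1 r.2.1.1 r.2.1.2; μ b])) b := fun q => by
    refine (hasDerivAt_const b (N : ℝ)).sub ?_
    have h := (hasDerivAt_plaquette_dim_thooft hd hN hμ ((0 : Literature.Probability.LatticeModels.Site d), q) hb).const_mul
      (N : ℝ)
    refine h.congr_of_eventuallyEq (Filter.Eventually.of_forall fun t => ?_)
    exact integral_plaquetteObs_eq_mul ((0 : Literature.Probability.LatticeModels.Site d), q) (μ t)
  have hsum := (HasDerivAt.fun_sum (u := (Finset.univ : Finset (𝔓 d))) fun q _ => hplane q).fun_neg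
  have he : HasDerivAt (fun t => -∑ q : 𝔓 d, ((N : ℝ) - ∫ U, plaquetteObs (fundamentalRep (Fin N)) 0 q.1.1 q.1.2 U ∂(μ t)))
      (∑ q : 𝔓 d, (N : ℝ) ^ 2 * ∑' r : ZdPlaquette d, cov[zdPlaquetteObs (fundamentalRep (Fin N)) 0 q.1.1 q.1.2,
        zdPlaquetteObs (fundamentalRep (Fin N)) r.1 r.2.1.1 r.2.1.2; μ b]) b := by
    refine hsum.congr_deriv ?_
    rw [← Finset.sum_neg_distrib]
    exact Finset.sum_congr rfl fun q _ => by ring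
  refine he.congr_of_eventuallyEq ?_
  filter_upwards [Ioo_mem_nhds hb.1 hb.2] with t ht
  exact (hasDerivAt_freeEnergyDensity_dim_thooft hd hN hμ ht).deriv

/-- ★ / ★★ **Selection-free forms, every `SU(N)`, every `d ≥ 2`**: for EVERY DLR state `ν ∈ 𝒢(b)`,
`0 < b < N/(12(d-1))`, `HasDerivAt f (-e(ν)) b` and `HasDerivAt f' (Σ_{i<j} N² Σ_q Cov_ν(W_{p_ij}, W_q)) b`. -/
theorem hasDerivAt_freeEnergyDensity_dim_thooft_of_mem (hd : 2 ≤ d) (hN : 2 ≤ N) {b : ℝ}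
    (hb : b ∈ Ioo (0 : ℝ) ((N : ℝ) / (12 * ((d : ℝ) - 1))))
    {ν : Measure (LGConfig d (Matrix.specialUnitaryGroup (Fin N) ℂ))}
    (hν : ν ∈ ymGibbsMeasures (d := d) (fundamentalRep (Fin N)) b) :
    HasDerivAt (freeEnergyDensity d (fundamentalRep (Fin N)))
        (-∑ q : 𝔓 d, ((N : ℝ) - ∫ U, plaquetteObs (fundamentalRep (Fin N)) 0 q.1.1 q.1.2 U ∂ν)) b ∧
      HasDerivAt (deriv (freeEnergyDensity d (fundamentalRep (Fin N))))
        (∑ q : 𝔓 d, (N : ℝ) ^ 2 * ∑' r : ZdPlaquette d, cov[zdPlaquetteObs (fundamentalRep (Fin N)) 0 q.1.1 q.1.2,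
          zdPlaquetteObs (fundamentalRep (Fin N)) r.1 r.2.1.1 r.2.1.2; ν]) b := by
  classical
  obtain ⟨μ, hμ⟩ := CouplingResponse.exists_dlrSelection_dim (d := d) (N := N)
  have hsel : ∀ t ∈ Icc (0 : ℝ) ((N : ℝ) / (12 * ((d : ℝ) - 1))),
      (fun t => if t = b then ν else μ t) t ∈ ymGibbsMeasures (d := d) (fundamentalRep (Fin N)) t := by
    intro t _
    by_cases ht : t = b
    · simp only [ht, if_true]; exact hν
    · simp only [ht, if_false]; exact hμ t
  constructor
  · simpa using hasDerivAt_freeEnergyDensity_dim_thooft hd hN hsel hb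
  · simpa using hasDerivAt_deriv_freeEnergyDensity_dim_thooft hd hN hsel hb

/-- ★★ **Every `SU(N)`, `N ≥ 2`, every `d ≥ 2`: `f ∈ C²` on the open window `(0, N/(12(d-1)))`**, hypothesis-free — no
first- or second-order transition of `SU(N)` lattice Yang–Mills on `ℤ^d` in the strong-coupling window, as a kernel
theorem about the free energy density. -/
theorem contDiffOn_two_freeEnergyDensity_dim_thooft (hd : 2 ≤ d) (hN : 2 ≤ N) :
    ContDiffOn ℝ 2 (freeEnergyDensity d (fundamentalRep (Fin N))) (Ioo (0 : ℝ) ((N : ℝ) / (12 * ((d : ℝ) - 1)))) := by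
  obtain ⟨μ, hμ⟩ := CouplingResponse.exists_dlrSelection_dim (d := d) (N := N)
  have hsel : ∀ t ∈ Icc (0 : ℝ) ((N : ℝ) / (12 * ((d : ℝ) - 1))),
      μ t ∈ ymGibbsMeasures (d := d) (fundamentalRep (Fin N)) t := fun t _ => hμ t
  obtain ⟨h1, hK0, hdoor⟩ := bakryEmery_door_dim (N := N) hd (by omega)
  have hmod := oneLinkKRModulus_SU hN h1
  rw [show (2 : WithTop ℕ∞) = 1 + 1 from rfl, contDiffOn_succ_iff_deriv_of_isOpen isOpen_Ioo]
  refine ⟨fun t ht => (hasDerivAt_freeEnergyDensity_dim_thooft hd hN hsel ht).differentiableAt.differentiableWithinAt,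
    fun h => absurd h (by simp), ?_⟩
  refine contDiffOn_one_of_hasDerivAt (fun t ht => hasDerivAt_deriv_freeEnergyDensity_dim_thooft hd hN hsel ht) ?_
  refine continuousOn_finsetSum _ fun q _ => continuousOn_const.mul ?_
  exact continuousOn_responseSum_dim hd (by omega) hK0 hmod le_rfl hdoor hsel
    (isLipschitzCylinder_zdPlaquetteObs (N := N) (0 : Literature.Probability.LatticeModels.Site d) q.2)
    (x₀ := 0) (D := 1) (fun e he => by simpa using norm_fst_sub_le_of_mem_plaquetteEdges he)

/-- The 't Hooft `C²` window in `d = 4` from the every-`d` row is `(0, N/36)`, narrower than the `d = 4` row's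
`(0, N·9/308)` (vertex-star door with the `d = 4` Lemma-G bookkeeping): `N/36 < N·9/308`. [folklore] -/
theorem dim_four_window_lt_star_window (hN : 1 ≤ N) : (N : ℝ) / (12 * ((4 : ℝ) - 1)) < (N : ℝ) * (9 / 308) := by
  have hN0 : (0 : ℝ) < N := by exact_mod_cast (show 0 < N by omega)
  nlinarith

end Dim

end Summit.Ventures.YMGap.PressureRegularity

end
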